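/-
Copyright (c) 2026 the pub-hodgecm-mathlib formalisation cell (harness21).  Prover seat hodgecm-mathlib-K2E3-p28 (g0), HCML Track B «K2-LIT» (CLOSE-OUT DAY, strike line L4
`stub_StCharTS`), h413 = `stmt-HodgeConjecture-24833`, line `K2_E3_EllipticInputs`, unit U12 «Characters», PART «SC» leaf (SC-an)₂, (M5e)₂∕(M5h)₂ chain, brick (M5a)+₂ —
the place-frame binders `hKB` (Iwasawa) and `hunimod` of ★ `K2E3SplitTorusOrbitalBoundRankOneTwo` DISCHARGED at a non-split place `K = L_w`; the `Fin 2` twin of ★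
`K2E3SplitTorusOrbitalBoundPlace` (K2E3-p20 (g4)) (dealer K2E3-plan (g4) D143, `K2/STATUS.md` 2026-09-04T15:02:09Z).
-/
import Summits.HodgeConjecture.HodgeConjecture.Theorems.K2E3SplitTorusOrbitalBoundRankOneTwo  -- (this seat, D143 2∕3): the model head `exists_const_lintegral_descConj_torusU_le` (Thm 14 on the split torus of `U(σ, Φ₂)(K)`)
import Summits.HodgeConjecture.HodgeConjecture.Theorems.K2E3SupercuspModelFrameAtPlaceTwo     -- ★ p861132 [M2a]₂ (K2E3-p31 (g0)): `isMulRightInvariant_of_isHaarMeasure_of_eq_over`, `locallyCompactSpace_unitaryGroupOfForm_adicCompletion` (`Fin 2`); brings ★ [M2a] (`secondCountableTopology_unitaryGroupOfForm_adicCompletion`, generic `{N}`; ★ `secondCountableTopology_adicCompletion`) and ★ `localNonsplitEquiv`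
import Literature.NumberTheory.Automorphic.UnitaryGroupCMLocalIwasawa                         -- ★ `exists_mem_cmLocalIntegralLevel_mul_borel` (`U(Φ_N)(L⁺_v) = K_v · B`, ANY `N`); brings ★ `isCompact_isOpen_cmLocalIntegralLevel`
import HarnessLib

/-!
# h413 ∕ Track B «K2-LIT», (SC-an)₂ leaf, brick (M5a)+₂: THEOREM 14 ON THE SPLIT TORUS AT A NON-SPLIT PLACE — the frame binders of ★ `K2E3SplitTorusOrbitalBoundRankOneTwo`
# (`hKB` Iwasawa, `hunimod`) DISCHARGED for `K = L_w`, `σ = σ_w`, `J = Φ₂`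
# (Bruhat–Tits 1972 (4.4.3): `G = B·K`; Harish-Chandra 1970, Part VI §8 Thm 14; the rank-one twin of ★ `K2E3SplitTorusOrbitalBoundPlace`)

Cell `pub/hodgecm-mathlib`, crux H413 = `stmt-HodgeConjecture-24833`, route of record `HCCMUnconditional`; chair K2-lead (g2), L4 LINE-LEAD ∕ dealer K2E3-plan (g4), architect
K2E3-p25 (g3).  THEOREMS ONLY (no `def`, no `instance`, no `notation`, no named-fact hypothesis, no `sorry`); lane `--supports stmt-HodgeConjecture-24833 --as helper`, count-neutral.

WHAT.  ★ `K2E3SplitTorusOrbitalBoundRankOneTwo.exists_const_lintegral_descConj_torusU_le` (Theorem 14 for the split Cartan of the model `U(σ, Φ₂)(K)`, this seat) keeps two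
structural binders that are theorems only at a place — `hKB : ∀ g, ∃ k ∈ K₁, ∃ b ∈ borelU σ J, g = k·b` for some compact subgroup `K₁` (Iwasawa), and `hunimod` (every Haar
measure of `U` is right invariant).  For the ONE-PLACE MODEL at a non-split place `v` of `L⁺` (`w ∣ v`, `c·w = w`, `K := L_w`, `σ := σ_w = galAdicCompletionMap c hw`,
`J := (StdForm.antidiagonal 2).over L_w`) both ARE theorems:
* §1 **`exists_isCompact_subgroup_mul_borelU_of_eq_over`** — `U(σ_w, Φ₂)(L_w) = K₁ · B` with `K₁` compact: transport of the `{N}`-GENERIC ★ `exists_mem_cmLocalIntegralLevel_mul_borel`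
  (`U(Φ₂)(L⁺_v) = U(Φ₂)(𝒪_v) · B`, ★ `UnitaryGroupCMLocalIwasawa`, from [BruhatTits1972, (4.4.3)]) along the one-place model ★ `localNonsplitEquiv` (`U(Φ₂)(L⁺_v) ≃ₜ*
  U(σ_w, Φ₂^{(w)})(L_w)`, upper triangular ↦ upper triangular since the equivalence is the `w`-component entrywise), with `K₁ := e(U(Φ₂)(𝒪_v))` compact (★
  `isCompact_isOpen_cmLocalIntegralLevel`) and the frame identity `placeForm Φ₂ w = (StdForm.antidiagonal 2).over L_w` (★ `antidiagOne_eq_over` ∕ `StdForm.over_map` — ★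
  `F0P3cCMLocalNonsplitBorelTransportU2.placeForm_antidiagTwo_eq`'s one-liner, re-derived here to keep the import closure small);
* §2 **`exists_const_lintegral_descConj_torusU_le_place`** — Theorem 14 on the split torus of `U(σ_w, Φ₂)(L_w)` with NO structural hypothesis left: the model head with `hKB` := §1,
  `hunimod` := ★ [M2a]₂ `K2E3SupercuspModelFrameAtPlaceTwo.isMulRightInvariant_of_isHaarMeasure_of_eq_over`, `hσc` := ★ `continuous_galAdicCompletionMap`, and the countability ∕
  local-compactness instances (★ [M2a] `secondCountableTopology_unitaryGroupOfForm_adicCompletion`, generic `{N}`; ★ [M2a]₂ `locallyCompactSpace_unitaryGroupOfForm_adicCompletion`;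
  ★ `secondCountableTopology_adicCompletion`) ALL discharged — the template's §2 token for token at `Fin 2` (no `hσ`, no `h2` in rank one).

HONEST LABEL.  HC_CM is proved only modulo the 7 printed citations (2 remaining named inputs: hLiu418 = `stmt-HodgeConjecture-24832`, h413 = `stmt-HodgeConjecture-24833`)
until rung 0 closes; count-neutral helper (frame plumbing for the (M5e)₂∕(M5h)₂ assembly; nothing printed is asserted as a fact); (SC-an)₂ stays OPEN.

## References
* [BruhatTits1972] F. Bruhat, J. Tits, *Groupes réductifs sur un corps local I*, Publ. Math. IHÉS 41 (1972), (4.4.3) (Iwasawa decomposition `G = B K`).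
* [HarishChandra1970] Harish-Chandra (notes by G. van Dijk), *Harmonic Analysis on Reductive p-adic Groups*, LNM 162 (1970), Part VI §8 Theorem 14 p. 60; Part VII §3 p. 72.
* [Rogawski1990] J. D. Rogawski, *Automorphic Representations of Unitary Groups in Three Variables*, Ann. of Math. Stud. 123 (1990), §3.6 p. 31; §4.5 p. 45; §4.9 p. 54–55;
  §4.13 p. 70.
* [PlatonovRapinchuk1994] V. Platonov, A. Rapinchuk, *Algebraic Groups and Number Theory* (1994), §3.5, §5.1.
-/

set_option autoImplicit false
set_option linter.dupNamespace false  -- the mandated namespace repeats the single-problem summit's segment (`HodgeConjecture.HodgeConjecture`)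

noncomputable section

open NumberField IsDedekindDomain MeasureTheory Measure Set
open scoped ENNReal NNReal Matrix MatrixGroups
open Literature.MeasureTheory.Group
open Literature.NumberTheory.Automorphic Literature.NumberTheory.Automorphic.UnitaryGroup Literature.NumberTheory.Rogawski1990
open Summit.HodgeConjecture.HodgeConjecture.Cruxes.H413

namespace Summit.HodgeConjecture.HodgeConjecture.Cruxes.H413.K2E3SplitTorusOrbitalBoundPlaceTwo

variable (L : Type) [Field L] [NumberField L] [IsCMField L] {v : HeightOneSpectrum (𝓞 ↥(maximalRealSubfield L))}
  (w : PlacesOver L v) (hw : IsCMField.complexConj L • w.1 = w.1)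

/-! ## §1 The Iwasawa decomposition of the one-place model: `U(σ_w, Φ₂)(L_w) = K₁ · B` -/

/-- **`U(σ_w, Φ₂)(L_w) = K₁ · B` FOR A COMPACT SUBGROUP `K₁`** (the `hKB` binder of ★ `K2E3SplitTorusOrbitalBoundRankOneTwo.exists_const_lintegral_descConj_torusU_le` at the place):
`K₁` is the image under the one-place model ★ `localNonsplitEquiv` of the integral level `U(Φ₂)(𝒪_v)` (compact open, ★ `isCompact_isOpen_cmLocalIntegralLevel`), and the
decomposition is the `{N}`-GENERIC ★ `exists_mem_cmLocalIntegralLevel_mul_borel` (`U(Φ₂)(L⁺_v) = K_v · B`) read at `w` (upper triangular ↦ upper triangular, Mathlib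
`Matrix.BlockTriangular.map`).  The `Fin 2` twin of ★ `K2E3SplitTorusOrbitalBoundPlace.exists_isCompact_subgroup_mul_borelU_of_eq_over`, same binders.
[cite: BruhatTits1972, (4.4.3)] [cite: Rogawski1990, §4.5 p. 45] [cite: PlatonovRapinchuk1994, §5.1] -/
theorem exists_isCompact_subgroup_mul_borelU_of_eq_over {J : Matrix (Fin 2) (Fin 2) (w.1.adicCompletion L)}
    (hJ : J = (StdForm.antidiagonal 2).over (w.1.adicCompletion L)) :
    ∃ K₁ : Subgroup ↥(unitaryGroupOfForm (galAdicCompletionMap (L := L) (IsCMField.complexConj L) hw) J),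
      IsCompact (K₁ : Set ↥(unitaryGroupOfForm (galAdicCompletionMap (L := L) (IsCMField.complexConj L) hw) J)) ∧
      ∀ g : ↥(unitaryGroupOfForm (galAdicCompletionMap (L := L) (IsCMField.complexConj L) hw) J),
        ∃ k ∈ K₁, ∃ b ∈ borelU (galAdicCompletionMap (L := L) (IsCMField.complexConj L) hw) J, g = k * b := by
  -- the frame identity `placeForm Φ₂ w = Φ₂ over L_w` (★ `antidiagOne_eq_over`, `StdForm.over_map`)
  have hpf : placeForm (Matrix.of fun i j : Fin 2 => if i.val + j.val + 1 = 2 then (1 : L) else 0) w.1 =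
      (StdForm.antidiagonal 2).over (w.1.adicCompletion L) := by
    rw [placeForm, antidiagOne_eq_over, StdForm.over_map]
  obtain rfl : J = placeForm (Matrix.of fun i j : Fin 2 => if i.val + j.val + 1 = 2 then (1 : L) else 0) w.1 := hJ.trans hpf.symm
  set e₀ := localNonsplitEquiv (IsCMField.complexConj L) (Matrix.of fun i j : Fin 2 => if i.val + j.val + 1 = 2 then (1 : L) else 0)
    (IsCMField.complexConj_ne_one L) w hw with he₀
  refine ⟨(cmLocalIntegralLevel L 2 (Matrix.of fun i j : Fin 2 => if i.val + j.val + 1 = 2 then (1 : L) else 0) v).map e₀.toMonoidHom, ?_, fun g => ?_⟩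
  · rw [Subgroup.coe_map]
    exact (isCompact_isOpen_cmLocalIntegralLevel L 2 (Matrix.of fun i j : Fin 2 => if i.val + j.val + 1 = 2 then (1 : L) else 0) v).1.image e₀.continuous
  · obtain ⟨κ, hκ, h, hg⟩ := exists_mem_cmLocalIntegralLevel_mul_borel L 2 v (e₀.symm g)
    -- the Borel element `h` viewed in the ambient group `U(Φ₂)(L⁺_v)` (= the domain of `e₀`, `rfl`)
    set h' : ↥(unitaryGroupOfForm (conjLocal L (IsCMField.complexConj L) v) (cmLocalForm L 2 v)) :=
      (h : ↥(unitaryGroupOfForm (conjLocal L (IsCMField.complexConj L) v) (cmLocalForm L 2 v))) with hh'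
    have hP : h' ∈ borelU (conjLocal L (IsCMField.complexConj L) v) (cmLocalForm L 2 v) := h.2
    refine ⟨e₀ κ, Subgroup.mem_map_of_mem (K := cmLocalIntegralLevel L 2 (Matrix.of fun i j : Fin 2 => if i.val + j.val + 1 = 2 then (1 : L) else 0) v)
      e₀.toMonoidHom hκ, e₀ h', ?_, ?_⟩
    · -- `e₀ h` is upper triangular: its matrix is the `w`-component of the (upper triangular) matrix of `h` (★ `localNonsplitEquiv` is entrywise `rfl`)
      have hh := (mem_borelU_iff h').1 hP
      rw [mem_borelU_iff]
      exact hh.map (Pi.evalRingHom (fun w' : PlacesOver L v => w'.1.adicCompletion L) w)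
    · have h1 : e₀.symm g = κ * h' := hg
      calc g = e₀ (e₀.symm g) := (e₀.apply_symm_apply g).symm
        _ = e₀ κ * e₀ h' := by rw [h1]; exact map_mul e₀ κ h'

/-! ## §2 Theorem 14 on the split torus at the place, structural binders discharged -/

/-- **HARISH-CHANDRA'S THEOREM 14 ON THE SPLIT TORUS OF `U(σ_w, Φ₂)(L_w)`, HYPOTHESIS-FREE IN THE FRAME**: for every `U`-invariant measure `μQ` on `U ⧸ T` finite on compacta and
every compact `S ⊆ U` there is ONE `C : ℝ≥0` with `∫⁻_{U⧸T} Θ(ẏ t ẏ⁻¹) dμQ ≤ C · M · χ⁻(b−1)⁻¹` for every measurable `Θ : U → [0,∞]` vanishing off `S` and bounded by `M`, and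
every regular diagonal `t = diag d` (`b − 1 = d₀⁻¹d₁ − 1` a unit) — ★ `K2E3SplitTorusOrbitalBoundRankOneTwo`'s model head with `hKB` (§1), `hunimod` (★ [M2a]₂), `hσc` (★
`continuous_galAdicCompletionMap`) and the countability ∕ local-compactness instances (★ [M2a] ∕ [M2a]₂, ★ `secondCountableTopology_adicCompletion`) ALL discharged.  The `Fin 2` twin
of ★ `K2E3SplitTorusOrbitalBoundPlace.exists_const_lintegral_descConj_torusU_le_place` (one regularity binder `hb`, no `ha`; one-factor module).
[cite: HarishChandra1970, Part VI §8 Theorem 14 p. 60; Part VII §3 p. 72] [cite: Rogawski1990, §4.13 p. 70; §4.9 p. 54–55] [cite: BruhatTits1972, (4.4.3)] -/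
theorem exists_const_lintegral_descConj_torusU_le_place
    [MeasurableSpace (w.1.adicCompletion L)] [BorelSpace (w.1.adicCompletion L)]
    {J : Matrix (Fin 2) (Fin 2) (w.1.adicCompletion L)} (hJ : J = (StdForm.antidiagonal 2).over (w.1.adicCompletion L))
    [MeasurableSpace ↥(unitaryGroupOfForm (galAdicCompletionMap (L := L) (IsCMField.complexConj L) hw) J)]
    [BorelSpace ↥(unitaryGroupOfForm (galAdicCompletionMap (L := L) (IsCMField.complexConj L) hw) J)]
    [MeasurableSpace (↥(unitaryGroupOfForm (galAdicCompletionMap (L := L) (IsCMField.complexConj L) hw) J) ⧸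
      torusU (galAdicCompletionMap (L := L) (IsCMField.complexConj L) hw) J)]
    [BorelSpace (↥(unitaryGroupOfForm (galAdicCompletionMap (L := L) (IsCMField.complexConj L) hw) J) ⧸
      torusU (galAdicCompletionMap (L := L) (IsCMField.complexConj L) hw) J)]
    (μQ : Measure (↥(unitaryGroupOfForm (galAdicCompletionMap (L := L) (IsCMField.complexConj L) hw) J) ⧸
      torusU (galAdicCompletionMap (L := L) (IsCMField.complexConj L) hw) J))
    [SMulInvariantMeasure ↥(unitaryGroupOfForm (galAdicCompletionMap (L := L) (IsCMField.complexConj L) hw) J)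
      (↥(unitaryGroupOfForm (galAdicCompletionMap (L := L) (IsCMField.complexConj L) hw) J) ⧸
        torusU (galAdicCompletionMap (L := L) (IsCMField.complexConj L) hw) J) μQ]
    [IsFiniteMeasureOnCompacts μQ]
    {S : Set ↥(unitaryGroupOfForm (galAdicCompletionMap (L := L) (IsCMField.complexConj L) hw) J)} (hS : IsCompact S) :
    ∃ C : ℝ≥0, ∀ (Θ : ↥(unitaryGroupOfForm (galAdicCompletionMap (L := L) (IsCMField.complexConj L) hw) J) → ℝ≥0∞), Measurable Θ →
      (∀ g, Θ g ≠ 0 → g ∈ S) → ∀ (M : ℝ≥0∞), (∀ g, Θ g ≤ M) →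
      ∀ (t : ↥(torusU (galAdicCompletionMap (L := L) (IsCMField.complexConj L) hw) J))
        (ht : ∀ a ∈ torusU (galAdicCompletionMap (L := L) (IsCMField.complexConj L) hw) J,
          a * (t : ↥(unitaryGroupOfForm (galAdicCompletionMap (L := L) (IsCMField.complexConj L) hw) J)) =
            (t : ↥(unitaryGroupOfForm (galAdicCompletionMap (L := L) (IsCMField.complexConj L) hw) J)) * a)
        (d : Fin 2 → (w.1.adicCompletion L)ˣ)
        (hd : glDiagonal 2 (w.1.adicCompletion L) d =
          ((t : ↥(unitaryGroupOfForm (galAdicCompletionMap (L := L) (IsCMField.complexConj L) hw) J)) : GL (Fin 2) (w.1.adicCompletion L)))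
        (hb : IsUnit ((((d 0)⁻¹ * d 1 : (w.1.adicCompletion L)ˣ) : w.1.adicCompletion L) - 1)),
        ∫⁻ q, descConj (t : ↥(unitaryGroupOfForm (galAdicCompletionMap (L := L) (IsCMField.complexConj L) hw) J))
            (torusU (galAdicCompletionMap (L := L) (IsCMField.complexConj L) hw) J) ht Θ q ∂μQ ≤
          C * M * (((HeisRing.skewModulus (galAdicCompletionMap (L := L) (IsCMField.complexConj L) hw) (continuous_galAdicCompletionMap L (IsCMField.complexConj L) hw)
              hb.unit (LineRing.map_unit_torusScalar_sub_one_two (galAdicCompletionMap (L := L) (IsCMField.complexConj L) hw) hJ t hd hb))⁻¹ : ℝ≥0) : ℝ≥0∞) := by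
  haveI : SecondCountableTopology (w.1.adicCompletion L) := secondCountableTopology_adicCompletion L w.1
  haveI : SecondCountableTopology ↥(unitaryGroupOfForm (galAdicCompletionMap (L := L) (IsCMField.complexConj L) hw) J) :=
    K2E3SupercuspModelFrameAtPlace.secondCountableTopology_unitaryGroupOfForm_adicCompletion L w _ J
  haveI : LocallyCompactSpace ↥(unitaryGroupOfForm (galAdicCompletionMap (L := L) (IsCMField.complexConj L) hw) J) :=
    K2E3SupercuspModelFrameAtPlaceTwo.locallyCompactSpace_unitaryGroupOfForm_adicCompletion L w hw J
  obtain ⟨K₁, hK₁, hKB⟩ := exists_isCompact_subgroup_mul_borelU_of_eq_over L w hw hJ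
  exact K2E3SplitTorusOrbitalBoundRankOneTwo.exists_const_lintegral_descConj_torusU_le (galAdicCompletionMap (L := L) (IsCMField.complexConj L) hw)
    (continuous_galAdicCompletionMap L (IsCMField.complexConj L) hw) hJ
    (fun ν hν => by haveI := hν; exact K2E3SupercuspModelFrameAtPlaceTwo.isMulRightInvariant_of_isHaarMeasure_of_eq_over L w hw hJ ν) hK₁ hKB μQ hS

end Summit.HodgeConjecture.HodgeConjecture.Cruxes.H413.K2E3SplitTorusOrbitalBoundPlaceTwo

end
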